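import Summits.FinalStateConjecture.FinalStateConjecture.Theorems.DerivativeThriftThriftyHandoffDefs
import Summits.FinalStateConjecture.FinalStateConjecture.Theses.DerivativeThrift
import Summits.FinalStateConjecture.FinalStateConjecture.Theses.PhaseMixingCapture
import Summits.FinalStateConjecture.FinalStateConjecture.Theses.TangentConeAtIPlus
import Summits.FinalStateConjecture.FinalStateConjecture.Theorems.PhaseMixingCaptureCaptureSufficesC2StubSelfWitnesses
import Literature.Geometry.Lorentzian.TameGenericityDiagonal
import Literature.Geometry.Lorentzian.TameBreathingCurve
import Literature.Geometry.Lorentzian.CauchyDevelopmentPrecomp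
import Literature.Geometry.Lorentzian.AFEndUnbreathe
import HarnessLib

/-!
# `ThriftyHandoff` (stmt-FinalStateConjecture-17612), line `registered` v3: stub 2a
# `stub_upgradableSelfWitness` — upgradably-censored data carry tame self-witness curves

Registered stub of the line skeleton `Cruxes/ThriftyHandoff/Lines/birth.lean` (v3), proved here by
name and signature. Through every admissible datum `d` with `UpgradableCensored d` (an MGHD exists;
every MGHD has complete `𝓘⁺` and upgrades weak thrifty hand-overs to full ones) passes a tame
(on a collar of the datum's own sole end), injective, immersed-at-`0` curve of admissible data ALL of
whose members are upgradably censored: the breathing curve of `d`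
(`AFEnd.breatheFamily`, `Literature/Geometry/Lorentzian/TameBreathingCurve.lean`), along which the
property is INVARIANT — its members are re-indexings `Φ_t^* d` by diffeomorphisms of `X`, their
vacuum Cauchy developments are those of `d` precomposed (`VacuumCauchyDevelopment.precomp`,
`InitialDataSet.comap`), maximality and complete `𝓘⁺` are transported
(`exists_isMaximal_comap_iff`, `forall_isMaximal_comap_iff`, `hasCompleteFutureNullInfinity_precomp_iff`),
and the two hand-over clauses read only the spacetime `(M, g, time orientation)` and `range ι`,
which `precomp` leaves unchanged (`range_precomp_embed`). Pattern:
`PhaseMixingCaptureCaptureSufficesC2StubSelfWitnesses.stub_quietSelfWitness`,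
`EIHFluxBalanceModulatedKerrHandoffTameTransport.handoffClause_precomp_iff`. This is the `P`-GOOD
half of the kernel's `hrel` leg (the birth cut asked it of the transversality stub as well; wave 1,
2026-08-17, found it closable and split it off); the genericity content of the crux sits entirely in
the other half (`stub_recessionAlongCensoredCurves`, exceptional base data). Proof found by the
line's wave-1 stub worker; no analysis beyond the cited transport lemmas.

The last section records the v3 COMPOSITION with this stub discharged:
`thriftyHandoff_of_legs'` — `ThriftyHandoff` from item stmt-FinalStateConjecture-17269
(`WeakCosmicCensorshipTame`) BY NAME, the corrected transversality stub (2b) and the weak capture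
stub (3) verbatim, and item stmt-FinalStateConjecture-17673 (`SettledExteriorHoldsRays`) BY NAME
(supersedes `thriftyHandoff_of_legs` of `…ThriftyHandoffReduction`, whose second hypothesis was the
over-cut birth form of the transversality stub).
-/

noncomputable section

-- D-0017: single-problem summit, `Summit.<S>.<S>.…` by design.
set_option linter.dupNamespace false

open Set Function Filter
open scoped Manifold ContDiff Topology

namespace Summit.FinalStateConjecture.FinalStateConjecture.Theorems.DerivativeThriftThriftyHandoff

open Literature.Geometry.Lorentzian
open Summit.FinalStateConjecture.FinalStateConjecture.Theorems.PhaseMixingCaptureCaptureSufficesC2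
  (injective_mfderiv_homeomorph_symm)

section Transport

variable {X : Type} [TopologicalSpace X] [ChartedSpace E3 X] [IsManifold (𝓡 3) ∞ X] [ConnectedSpace X]
  {D : InitialDataSet (𝓡 3) X} (𝒟 : VacuumCauchyDevelopment D) (Φ : X ≃ₜ X)
  (hΦ : ContMDiff (𝓡 3) (𝓡 3) (∞ + 1) Φ) (hΦ' : ∀ u, Injective (mfderiv (𝓡 3) (𝓡 3) Φ u))

/-- **The weak hand-over is invariant under re-indexing of the data**: `WeakHandoff` reads the
spacetime of `𝒟` and `range ι` only, and `𝒟.precomp Φ` has the same spacetime and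
`range (ι ∘ Φ) = range ι`. Sbierski, *On the existence of a maximal Cauchy development*, Ann. Henri
Poincaré 17 (2016), §2 (developments up to re-indexing). [folklore] -/
theorem weakHandoff_precomp_iff : WeakHandoff (𝒟.precomp Φ hΦ hΦ') ↔ WeakHandoff 𝒟 := by
  have hr : range (𝒟.precomp Φ hΦ hΦ').embed = range 𝒟.embed := 𝒟.range_precomp_embed Φ hΦ hΦ'
  unfold WeakHandoff
  simp only [hr]
  exact Iff.rfl

/-- **The full hand-over is invariant under re-indexing of the data** (same reason). [folklore] -/
theorem fullHandoff_precomp_iff : FullHandoff (𝒟.precomp Φ hΦ hΦ') ↔ FullHandoff 𝒟 := by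
  have hr : range (𝒟.precomp Φ hΦ hΦ').embed = range 𝒟.embed := 𝒟.range_precomp_embed Φ hΦ hΦ'
  unfold FullHandoff
  simp only [hr]
  exact Iff.rfl

/-- **The development-level clause of `UpgradableCensored` is invariant under re-indexing**:
complete `𝓘⁺` by `hasCompleteFutureNullInfinity_precomp_iff`, the upgrade implication by the two
previous lemmas. [folklore] -/
theorem upgradableClause_precomp_iff :
    (Summit.FinalStateConjecture.HasCompleteNullInfinity (𝒟.precomp Φ hΦ hΦ').toCauchyDevelopment ∧
        (WeakHandoff (𝒟.precomp Φ hΦ hΦ') → FullHandoff (𝒟.precomp Φ hΦ hΦ'))) ↔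
      (Summit.FinalStateConjecture.HasCompleteNullInfinity 𝒟.toCauchyDevelopment ∧
        (WeakHandoff 𝒟 → FullHandoff 𝒟)) := by
  refine and_congr (𝒟.hasCompleteFutureNullInfinity_precomp_iff Φ hΦ hΦ') ?_
  exact imp_congr (weakHandoff_precomp_iff 𝒟 Φ hΦ hΦ') (fullHandoff_precomp_iff 𝒟 Φ hΦ hΦ')

/-- **`UpgradableCensored` is invariant under `D ↦ Φ^* D`** for a diffeomorphism `Φ` of `X`:
MGHD existence and the `∀ MGHD` clause are transported along `comap`/`precomp`
(`exists_isMaximal_comap_iff`, `forall_isMaximal_comap_iff`). [folklore] -/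
theorem upgradableCensored_comap_iff (hΨ : ContMDiff (𝓡 3) (𝓡 3) (∞ + 1) Φ.symm)
    (hΨ' : ∀ u, Injective (mfderiv (𝓡 3) (𝓡 3) Φ.symm u)) :
    UpgradableCensored (D.comap Φ hΦ hΦ') ↔ UpgradableCensored D := by
  unfold UpgradableCensored
  refine and_congr (VacuumCauchyDevelopment.exists_isMaximal_comap_iff Φ hΦ hΦ' hΨ hΨ') ?_
  exact VacuumCauchyDevelopment.forall_isMaximal_comap_iff Φ hΦ hΦ' hΨ hΨ'
    (fun {D'} 𝒟 ↦ Summit.FinalStateConjecture.HasCompleteNullInfinity 𝒟.toCauchyDevelopment ∧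
      (WeakHandoff 𝒟 → FullHandoff 𝒟))
    fun 𝒟 Θ hΘ hΘ' ↦ upgradableClause_precomp_iff 𝒟 Θ hΘ hΘ'

end Transport

section Breathe

variable {X : Type} [TopologicalSpace X] [ChartedSpace E3 X] [IsManifold (𝓡 3) ∞ X] [T2Space X]
  [ConnectedSpace X] {e : AFEnd X} {z₀ : E3} {r : ℝ} (B : AFEnd.BreathingData e z₀ r) (d : InitialDataSet (𝓡 3) X)

/-- **`UpgradableCensored` passes between a datum and every member of its breathing family** (the
members are `comap`s of `d` by the breathing diffeomorphisms). [folklore] -/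
theorem upgradableCensored_breatheFamily (t : ℝ) :
    UpgradableCensored (AFEnd.breatheFamily B d t) ↔ UpgradableCensored d := by
  set Φ : X ≃ₜ X := AFEnd.breatheHomeomorph B (AFEnd.abs_squash_lt_invScale B t) with hΦdef
  have hΦ : ContMDiff (𝓡 3) (𝓡 3) (∞ + 1) Φ :=
    AFEnd.contMDiff_breathe_succ B (AFEnd.abs_squash_lt_scale B t).2
  have hΦ' : ∀ u, Injective (mfderiv (𝓡 3) (𝓡 3) Φ u) :=
    (AFEnd.breatheScale_spec B).2.2 _ (AFEnd.abs_squash_lt_scale B t).1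
  have hΨ : ContMDiff (𝓡 3) (𝓡 3) (∞ + 1) Φ.symm := AFEnd.contMDiff_unbreathe B _
  have hΨ' : ∀ u, Injective (mfderiv (𝓡 3) (𝓡 3) Φ.symm u) :=
    injective_mfderiv_homeomorph_symm Φ hΦ hΨ
  have key : AFEnd.breatheFamily B d t = d.comap Φ hΦ hΦ' := rfl
  rw [key]
  exact upgradableCensored_comap_iff Φ hΦ hΦ' hΨ hΨ'

end Breathe

/-- **Stub 2a of line `registered` (v3), by name and signature: upgradably-censored admissible data
carry tame self-witness curves.** Through every `d ∈ admissibleVacuumData X` with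
`UpgradableCensored d` passes a curve `F'` of admissible data, tame on a collar of the datum's sole
end, `F' 0 = d`, injective and immersed at `0`, with `UpgradableCensored (F' c)` for all `c ≠ 0`
(indeed for all `c`): the breathing curve of `d` far out on its end
(`AFEnd.isTameDataFamily_restrict_breatheCurve`, `injective_breatheCurve`,
`isImmersedAtZero_breatheCurve`, `breatheCurve_mem_admissibleVacuumData`) and invariance
(`upgradableCensored_breatheFamily`). Christodoulou, CQG 16 (1999) A23, p. A24 (witness curves in a
fixed space of data). [cite: Christodoulou1999, p. A24] -/
theorem stub_upgradableSelfWitness : open Literature.Geometry.Lorentzian Summit.FinalStateConjecture.FinalStateConjecture.Theorems.DerivativeThriftThriftyHandoff in open scoped Manifold in ∀ (X : Type) [TopologicalSpace X] [ChartedSpace E3 X] [IsManifold (𝓡 3) ((⊤ : ℕ∞) : WithTop ℕ∞) X] [T2Space X] [SecondCountableTopology X] [ConnectedSpace X], ∀ d ∈ admissibleVacuumData X, UpgradableCensored d → ∃ (e' : AFEnd X) (F' : EuclideanSpace ℝ (Fin 1) → InitialDataSet (𝓡 3) X), InitialDataSet.IsTameDataFamily e' 1 F' ∧ F' 0 = d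 ∧ Function.Injective F' ∧ InitialDataSet.IsImmersedAtZero 1 F' ∧ (∀ c, F' c ∈ admissibleVacuumData X) ∧ ∀ c ≠ 0, UpgradableCensored (F' c) := by
  intro X _ _ _ _ _ _ d hd hP
  obtain ⟨-, e₀, M, hsole, hdecay⟩ := id hd
  -- a breathing ball far out on the sole end of `d`
  set z₀ : E3 := (e₀.R + 3) • EuclideanSpace.single (0 : Fin 3) (1 : ℝ) with hz₀
  have hz₀n : ‖z₀‖ = e₀.R + 3 := by
    rw [hz₀, norm_smul, PiLp.norm_single, norm_one, mul_one,
      Real.norm_of_nonneg (by linarith [e₀.R_pos])]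
  have B : e₀.BreathingData z₀ 1 := ⟨one_pos, by rw [hz₀n]; linarith⟩
  have hR₁ : e₀.R < e₀.R + 1 := by linarith
  refine ⟨e₀.restrict hR₁.le, fun c ↦ AFEnd.breatheFamily B d (c 0),
    AFEnd.isTameDataFamily_restrict_breatheCurve B d hsole hdecay hR₁,
    AFEnd.breatheCurve_zero B d, AFEnd.injective_breatheCurve B d,
    AFEnd.isImmersedAtZero_breatheCurve B d,
    fun c ↦ AFEnd.breatheCurve_mem_admissibleVacuumData B d hd c, fun c _ ↦ ?_⟩
  exact (upgradableCensored_breatheFamily B d (c 0)).2 hP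

/-! ### The v3 composition of line `registered`, stub 2a discharged -/

/-- **`ThriftyHandoff` from its v3 legs (hypothetical form, items by name, stub 2a discharged).**
The crux follows from: (1) `WeakCosmicCensorshipTame` (stmt-FinalStateConjecture-17269); (2b) the
corrected transversality stub `stub_recessionAlongCensoredCurves` verbatim — along every tame curve of
admissible data whose base datum is NOT upgradably censored and whose members off `0` are censored,
a tame injective immersed admissible curve on some end through the same base datum with upgradably
censored members off `0`; (3) `stub_censoredCapture` verbatim — every censored MGHD of admissible
data admits a weak thrifty hand-over; (4) `SettledExteriorHoldsRays` (stmt-FinalStateConjecture-17673).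
Proof: the kernel `isTameChristodoulouGeneric_of_relative'` with `Q := Censored`, its `hrel`
assembled by `by_cases UpgradableCensored (F 0)` from `stub_upgradableSelfWitness` (this file) and
(2b); then `.mono` with `thriftyProp_of_upgradableCensored` fed by (3) and (4). Christodoulou, CQG 16
(1999) A23, p. A24 (genericity along curves). [cite: Christodoulou1999, p. A24] -/
theorem thriftyHandoff_of_legs'
    (h₁ : Summit.FinalStateConjecture.FinalStateConjecture.Theses.PhaseMixingCapture.WeakCosmicCensorshipTame)
    (h₂ : open Literature.Geometry.Lorentzian Summit.FinalStateConjecture.FinalStateConjecture.Theorems.DerivativeThriftThriftyHandoff in open scoped Manifold in ∀ (X : Type) [TopologicalSpace X] [ChartedSpace E3 X] [IsManifold (𝓡 3) ((⊤ : ℕ∞) : WithTop ℕ∞) X] [T2Space X] [SecondCountableTopology X] [ConnectedSpace X], ∀ (e : AFEnd X) (F : EuclideanSpace ℝ (Fin 1) → InitialDataSet (𝓡 3) X), InitialDataSet.IsTameDataFamily e 1 F → ((InitialDataSet.IsImmersedAtZero 1 F ∧ Function.Injective F) ∨ ∀ c, F c = F 0) → (∀ c, F c ∈ admissibleVacuumData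 X) → ¬ UpgradableCensored (F 0) → (∀ c ≠ 0, Censored (F c)) → ∃ (e' : AFEnd X) (F' : EuclideanSpace ℝ (Fin 1) → InitialDataSet (𝓡 3) X), InitialDataSet.IsTameDataFamily e' 1 F' ∧ F' 0 = F 0 ∧ Function.Injective F' ∧ InitialDataSet.IsImmersedAtZero 1 F' ∧ (∀ c, F' c ∈ admissibleVacuumData X) ∧ ∀ c ≠ 0, UpgradableCensored (F' c))
    (h₃ : open Literature.Geometry.Lorentzian Summit.FinalStateConjecture.FinalStateConjecture.Theorems.DerivativeThriftThriftyHandoff in open scoped Manifold in ∀ (X : Type) [TopologicalSpace X] [ChartedSpace E3 X] [IsManifold (𝓡 3) ((⊤ : ℕ∞) : WithTop ℕ∞) X] [T2Space X] [SecondCountableTopology X] [ConnectedSpace X], ∀ D ∈ admissibleVacuumData X, ∀ 𝒟 : VacuumCauchyDevelopment D, 𝒟.IsMaximal → Summit.FinalStateConjecture.HasCompleteNullInfinity 𝒟.toCauchyDevelopment → WeakHandoff 𝒟)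
    (h₄ : Summit.FinalStateConjecture.FinalStateConjecture.Theses.TangentConeAtIPlus.SettledExteriorHoldsRays) :
    Summit.FinalStateConjecture.FinalStateConjecture.Theses.DerivativeThrift.ThriftyHandoff := by
  intro X _ _ _ _ _ _
  -- Step 1: tame genericity of the UPGRADABLE censored property, produced along censorship curves
  have key : InitialDataSet.IsTameChristodoulouGeneric (admissibleVacuumData X)
      (UpgradableCensored (X := X)) 1 := by
    refine InitialDataSet.isTameChristodoulouGeneric_of_relative' (Q := Censored (X := X))
      (fun d hd ↦ exists_isSoleEnd_of_mem_admissibleVacuumData hd) (h₁ X) ?_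
    intro e F hF hdich hadm hQ
    by_cases hP : UpgradableCensored (F 0)
    · exact stub_upgradableSelfWitness X (F 0) (hadm 0) hP
    · exact h₂ X e F hF hdich hadm hP hQ
  -- Step 2: pointwise upgrade on admissible data
  refine key.mono ?_
  intro D hD hP
  exact thriftyProp_of_upgradableCensored hP (h₃ X D hD) (h₄ X D hD)

end Summit.FinalStateConjecture.FinalStateConjecture.Theorems.DerivativeThriftThriftyHandoff

end
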